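import Mathlib
import Summits.Ventures.PercRepro.TriangleCapFiveRowThreeCap

/-!
# PercRepro — THE CAP ON THE CELL `(k, 5, 4)`, THE PIECES: the count (`E = 0`, `M ≤ 1` for `K ≥ 10`), the `K = 9`
structure lemma, the exact `R`-sum and the arithmetic (p3, gen 46; part 199v, first half)

With four missing pairs the count reads `2K + 2M + 2P + E = 10K − 8`, `P + 4M ≤ 4K`, `E ≤ 8`, and an edge inside `R`
forces `P + 2M ≤ 3K + 1` (`five_three_noedge`), so `E = 0` and `M ≤ 1` for `K ≥ 10`; AT `K = 9` (`k = 14`, the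
corner) an edge leaves `E = 8`, `M = 0`, `P = 28`, killed by the structure of part 199g (`five_four_noedge_nine`:
the two non-neighbours off the edge see all of `N`, are non-adjacent, and their `R`-neighbours see at most one
vertex of `N`). `M = 1` has `P = 4K − 5` with the four non-neighbours at most `K−1, K−1, K−1, K−2`
(`five_four_R_arith`). Axioms: standard.
-/

namespace PercRepro

namespace TriangleCap

namespace C047

open Finset

variable {V : Type*} [Fintype V] [DecidableEq V]

/-- The count at the cap of the cell `(k, 5, 4)`, `K ≥ 10`: `E = 0` and `M ≤ 1`. -/
theorem five_four_cap_count (K M P E m : ℕ) (hdeg : K + (K + 2 * M + P) + (P + E) = 2 * m) (hm : m + 4 = 5 * K)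
    (h2 : P + 4 * M ≤ 4 * K) (hE : E ≤ 8) (hK : 10 ≤ K) (hnoedge : 1 ≤ E → P + 2 * M ≤ 3 * K + 1) :
    E = 0 ∧ M ≤ 1 := by
  by_cases hE1 : 1 ≤ E
  · have := hnoedge hE1
    omega
  · omega

/-- The count at the cap of `(14, 5, 4)`: an edge inside `R` forces `E = 8`, `M = 0`, `P = 28`. -/
theorem five_four_cap_count_nine (M P E m : ℕ) (hdeg : 9 + (9 + 2 * M + P) + (P + E) = 2 * m) (hm : m + 4 = 5 * 9)
    (hE : E ≤ 8) (hE1 : 1 ≤ E) (hnoedge : P + 2 * M ≤ 3 * 9 + 1) :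
    E = 8 ∧ M = 0 ∧ P = 28 := by
  omega

/-- Four values `≤ K − 1` with sum `4K − 5` have `Σ x² + 10K ≤ 4K² + 7`. -/
theorem five_four_R_arith (x y z w K : ℕ) (hK : 9 ≤ K) (hx : x + 1 ≤ K) (hy : y + 1 ≤ K) (hz : z + 1 ≤ K)
    (hw : w + 1 ≤ K) (hsum : x + y + z + w + 5 = 4 * K) :
    x * x + y * y + z * z + w * w + 10 * K ≤ 4 * (K * K) + 7 := by
  obtain ⟨t, rfl⟩ : ∃ t, K = t + 9 := ⟨K - 9, by omega⟩
  obtain ⟨a, ha, rfl⟩ : ∃ a, a ≤ 1 ∧ x = t + 7 + a := ⟨x - (t + 7), by omega, by omega⟩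
  obtain ⟨b, hb, rfl⟩ : ∃ b, b ≤ 1 ∧ y = t + 7 + b := ⟨y - (t + 7), by omega, by omega⟩
  obtain ⟨c, hc, rfl⟩ : ∃ c, c ≤ 1 ∧ z = t + 7 + c := ⟨z - (t + 7), by omega, by omega⟩
  obtain ⟨d, hd, rfl⟩ : ∃ d, d ≤ 1 ∧ w = t + 7 + d := ⟨w - (t + 7), by omega, by omega⟩
  have habcd : a + b + c + d = 3 := by omega
  interval_cases a <;> interval_cases b <;> interval_cases c <;> interval_cases d <;> nlinarith

/-- **THE ARITHMETIC OF THE CASE `M = 1`:** `K ≥ 9`, `m + 4 = 5K`, `P + 5 = 4K`, `S_N ≤ K + 14 + 6P`,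
`S_R + 10K ≤ 4K² + 7` ⇒ `K² + S_N + S_R + 4 (k − 5) + 4 ≤ m k` with `k = K + 5`. -/
theorem five_four_cap_sq_arith (K P SN SR m : ℕ) (hK : 9 ≤ K) (hm : m + 4 = 5 * K) (hP : P + 5 = 4 * K)
    (hSN : SN ≤ K + 14 + 6 * P) (hSR : SR + 10 * K ≤ 4 * (K * K) + 7) :
    K * K + SN + SR + 4 * (K + 5 - 5) + 4 ≤ m * (K + 5) := by
  obtain ⟨t, rfl⟩ : ∃ t, K = t + 9 := ⟨K - 9, by omega⟩
  have hP' : P = 4 * t + 31 := by omega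
  have hm' : m = 5 * t + 41 := by omega
  subst hP' hm'
  have e1 : t + 9 + 5 - 5 = t + 9 := by omega
  rw [e1]
  nlinarith [hSN, hSR]

/-- **THE CAP OF `(14, 5, 4)` HAS NO EDGE INSIDE `R`:** with `|N| = 9`, no edge inside `N`, `Σ_R degIn N = 28` and
`adjPairs R = 8`, a contradiction: the two non-neighbours off the edge see all of `N`, are non-adjacent, and make
their `R`-neighbours see at most one vertex of `N`. -/
theorem five_four_noedge_nine (D : SimpleGraph V) [DecidableRel D.Adj] (hK : K4mFree D) (N R : Finset V)
    (hRcard : R.card = 4)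
    (hKdef : N.card = 9) (hPle : ∀ u ∈ R, degIn D N u ≤ 9) (hP : ∑ u ∈ R, degIn D N u = 28)
    (hE : adjPairs D R = 8) : False := by
  -- an edge `u v` inside `R`
  obtain ⟨u, hu, hu1⟩ : ∃ u ∈ R, 1 ≤ degIn D R u := by
    by_contra hcon
    push Not at hcon
    have h0 : ∑ u ∈ R, degIn D R u = 0 := sum_eq_zero (fun u hu => by have := hcon u hu; omega)
    rw [← adjPairs_eq_sum_degIn] at h0
    omega
  obtain ⟨v, hv, huv⟩ : ∃ v ∈ R, D.Adj u v := by
    unfold degIn at hu1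
    obtain ⟨v, hv⟩ := card_pos.mp hu1
    rw [mem_filter] at hv
    exact ⟨v, hv.1, hv.2⟩
  have hne : u ≠ v := D.ne_of_adj huv
  have hPuv : degIn D N u + degIn D N v ≤ 10 := by
    have := degIn_add_degIn_le_of_adj_pair D hK N huv
    rw [hKdef] at this
    exact this
  -- the other two vertices `w, w'`
  have hvR' : v ∈ R.erase u := mem_erase.mpr ⟨hne.symm, hv⟩
  have hcard2 : ((R.erase u).erase v).card = 2 := by
    rw [card_erase_of_mem hvR', card_erase_of_mem hu]
    omega
  obtain ⟨w, w', hww', hw2⟩ := card_eq_two.mp hcard2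
  have hwmem : w ∈ (R.erase u).erase v := by rw [hw2]; exact mem_insert_self w {w'}
  have hw'mem : w' ∈ (R.erase u).erase v := by rw [hw2]; exact mem_insert_of_mem (mem_singleton_self w')
  have hwv : w ≠ v := (mem_erase.mp hwmem).1
  have hwu : w ≠ u := (mem_erase.mp (mem_of_mem_erase hwmem)).1
  have hwR : w ∈ R := mem_of_mem_erase (mem_of_mem_erase hwmem)
  have hw'v : w' ≠ v := (mem_erase.mp hw'mem).1
  have hw'u : w' ≠ u := (mem_erase.mp (mem_of_mem_erase hw'mem)).1
  have hw'R : w' ∈ R := mem_of_mem_erase (mem_of_mem_erase hw'mem)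
  have hR4 : R = insert u (insert v (insert w {w'})) := by
    rw [← hw2, insert_erase hvR', insert_erase hu]
  have hsum4 : ∀ f : V → ℕ, ∑ t ∈ R, f t = f u + f v + f w + f w' := by
    intro f
    rw [hR4, sum_insert, sum_insert, sum_insert, sum_singleton, add_assoc, add_assoc]
    · rw [mem_singleton]; exact hww'
    · rw [mem_insert, mem_singleton]; push Not; exact ⟨hwv.symm, hw'v.symm⟩
    · rw [mem_insert, mem_insert, mem_singleton]; push Not; exact ⟨hne, hwu.symm, hw'u.symm⟩
  have hmemR4 : ∀ t, t ∈ R ↔ t = u ∨ t = v ∨ t = w ∨ t = w' := by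
    intro t
    rw [hR4, mem_insert, mem_insert, mem_insert, mem_singleton]
  -- `P_w = P_{w'} = 9`: they see all of `N`
  have hPw8 : degIn D N w = 9 ∧ degIn D N w' = 9 := by
    rw [hsum4] at hP
    have := hPle w hwR
    have := hPle w' hw'R
    omega
  have hall : ∀ t, degIn D N t = 9 → ∀ y ∈ N, D.Adj t y := by
    intro t ht y hy
    unfold degIn at ht
    have hsub : N.filter (fun s => D.Adj t s) ⊆ N := filter_subset _ _
    have heq : N.filter (fun s => D.Adj t s) = N := eq_of_subset_of_card_le hsub (by rw [ht, hKdef])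
    have : y ∈ N.filter (fun s => D.Adj t s) := by rw [heq]; exact hy
    exact (mem_filter.mp this).2
  have hwall := hall w hPw8.1
  have hw'all := hall w' hPw8.2
  -- two vertices of `N`
  obtain ⟨y₁, hy₁, y₂, hy₂, hy12⟩ : ∃ y₁ ∈ N, ∃ y₂ ∈ N, y₁ ≠ y₂ := by
    have h1 : 1 < N.card := by omega
    obtain ⟨y₁, hy₁, y₂, hy₂, h⟩ := one_lt_card.mp h1
    exact ⟨y₁, hy₁, y₂, hy₂, h⟩
  -- `w ≁ w'`
  have hnww' : ¬ D.Adj w w' := fun h =>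
    not_adj_both D hK h (hwall y₁ hy₁) (hw'all y₁ hy₁) hy12 (hwall y₂ hy₂) (hw'all y₂ hy₂)
  -- a vertex of `R` adjacent to `w` (or `w'`) sees at most one vertex of `N`
  have hone : ∀ t z, (∀ y ∈ N, D.Adj z y) → D.Adj t z → degIn D N t ≤ 1 := by
    intro t z hz htz
    unfold degIn
    apply card_le_one.mpr
    intro a ha b hb
    rw [mem_filter] at ha hb
    by_contra hab
    exact not_adj_both D hK htz ha.2 (hz a ha.1) hab hb.2 (hz b hb.1)
  -- `u` is adjacent to `w` or `w'`, and so is `v`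
  have hdegR : ∀ t ∈ R, degIn D R t ≤ 3 := fun t ht => by
    have := degIn_le_card_sub_one D ht
    rw [hRcard] at this
    exact this
  have hsub1 : ∀ t s₀, (∀ s ∈ R, D.Adj t s → s = s₀) → degIn D R t ≤ 1 := by
    intro t s₀ ht
    unfold degIn
    have : R.filter (fun s => D.Adj t s) ⊆ {s₀} := by
      intro s hs
      rw [mem_filter] at hs
      rw [mem_singleton]
      exact ht s hs.1 hs.2
    have := card_le_card this
    rw [card_singleton] at this
    exact this
  have hEsum : degIn D R u + degIn D R v + degIn D R w + degIn D R w' = 8 := by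
    rw [← hsum4, ← adjPairs_eq_sum_degIn, hE]
  have huw : D.Adj u w ∨ D.Adj u w' := by
    by_contra hcon
    push Not at hcon
    have h1 : degIn D R u ≤ 1 := hsub1 u v (fun s hs hus => by
      rcases (hmemR4 s).mp hs with rfl | rfl | rfl | rfl
      · exact absurd hus (D.irrefl)
      · rfl
      · exact absurd hus hcon.1
      · exact absurd hus hcon.2)
    have h3 : degIn D R w ≤ 1 := hsub1 w v (fun s hs hws => by
      rcases (hmemR4 s).mp hs with rfl | rfl | rfl | rfl
      · exact absurd (D.adj_symm hws) hcon.1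
      · rfl
      · exact absurd hws (D.irrefl)
      · exact absurd hws hnww')
    have h4 : degIn D R w' ≤ 1 := hsub1 w' v (fun s hs hws => by
      rcases (hmemR4 s).mp hs with rfl | rfl | rfl | rfl
      · exact absurd (D.adj_symm hws) hcon.2
      · rfl
      · exact absurd (D.adj_symm hws) hnww'
      · exact absurd hws (D.irrefl))
    have h2 := hdegR v hv
    omega
  have hvw : D.Adj v w ∨ D.Adj v w' := by
    by_contra hcon
    push Not at hcon
    have h2 : degIn D R v ≤ 1 := hsub1 v u (fun s hs hvs => by
      rcases (hmemR4 s).mp hs with rfl | rfl | rfl | rfl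
      · rfl
      · exact absurd hvs (D.irrefl)
      · exact absurd hvs hcon.1
      · exact absurd hvs hcon.2)
    have h3 : degIn D R w ≤ 1 := hsub1 w u (fun s hs hws => by
      rcases (hmemR4 s).mp hs with rfl | rfl | rfl | rfl
      · rfl
      · exact absurd (D.adj_symm hws) hcon.1
      · exact absurd hws (D.irrefl)
      · exact absurd hws hnww')
    have h4 : degIn D R w' ≤ 1 := hsub1 w' u (fun s hs hws => by
      rcases (hmemR4 s).mp hs with rfl | rfl | rfl | rfl
      · rfl
      · exact absurd (D.adj_symm hws) hcon.2
      · exact absurd (D.adj_symm hws) hnww'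
      · exact absurd hws (D.irrefl))
    have h1 := hdegR u hu
    omega
  have hPu1 : degIn D N u ≤ 1 := by
    rcases huw with h | h
    · exact hone u w hwall h
    · exact hone u w' hw'all h
  have hPv1 : degIn D N v ≤ 1 := by
    rcases hvw with h | h
    · exact hone v w hwall h
    · exact hone v w' hw'all h
  rw [hsum4] at hP
  omega

end C047

end TriangleCap

end PercRepro
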